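import Summits.BirchSwinnertonDyer.BirchSwinnertonDyer.Theses.SignedBaseChange
import Summits.BirchSwinnertonDyer.BirchSwinnertonDyer.Theorems.SignedBaseChangeAnticyclotomicEisensteinDivisibilityCoprimeClassNumberLive
import Summits.BirchSwinnertonDyer.BirchSwinnertonDyer.Theorems.SignedBaseChangeAnticyclotomicEisensteinDivisibilityS1OfSignedEisensteinMult
import Summits.BirchSwinnertonDyer.BirchSwinnertonDyer.Theorems.SignedBaseChangeAnticyclotomicEisensteinDivisibilityOfFiniteExponentTateTC
import Summits.BirchSwinnertonDyer.BirchSwinnertonDyer.Theorems.SignedBaseChangeAnticyclotomicEisensteinDivisibilityMinusIsBDPSupersingularBCS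
import HarnessLib

/-!
# Stub kit for the planner's «CoprimeSS» successor of the crux `AnticyclotomicEisensteinDivisibility` (stmt-BirchSwinnertonDyer-20727), v37
# CURRENCY: the crux ON THE SUB-CELL `a_p = 0 ∧ p ∤ h_K` from TWO stubs, against the v37 NAMED-FACTS TEXT (SEVEN conjuncts: the v37
# `stub_namedFactsSS` of `Lines/bdpline.lean` minus the Yan–Zhu triple — Harari Thm. 17.13 (a) DISCHARGED, Tate's global Euler
# characteristic at totally complex fields only) and the research stub `stub_bdpLowerHalfRatSS_mult` (BDP currency)

Lead seat bsd-line-sbc-p1 (gen 14), `--supports stmt-BirchSwinnertonDyer-20727`. POINTWISE COPY of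
`SignedBaseChangeAcDivCoprimeSupersingularBDPMult.anticyclotomicEisensteinDivisibility_ss_coprime_of_stubs_bdpmult` (p680714, lead gen 13) with the
Greenberg road exchanged for its `OfTateTC` re-plumb (this gen, p682978 + p683298): `hF` is the v37 `stub_namedFactsSS` text WITHOUT its first
conjunct — SEVEN conjuncts, refereed ×6 (LV19 1.4 · CW24 proof-of-6.8 inputs · Gr16 4.1.1 ∧ Milne ADT I Thm. 5.1 AT TOTALLY COMPLEX FIELDS · BCS25 ×2 ·
CHKLL25) + BLV26∘CW24 (flag K1) + ZERO preprint; the Poitou–Tate conjunct of p680714's `hF` is GONE (Harari Thm. 17.13 (a) is PROVED at totally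
complex fields, `GaloisCohomology.forall_poitouTate_restricted_three_le_of_isTotallyComplex`, cell `bsd-eis` p681302) and the finite exponent of
`X_Gr₂[T₁]` is read from Greenberg 2016 Prop. 4.1.1 + Tate (TC) by `SignedBaseChangeAcDivOfFiniteExponentTateTC.finiteExponentSS_of_prop411_of_tateTC`.
Everything else VERBATIM from p680714 (finite generation, (a1) torsion from LV19 + CW24 at `p ∤ h_K`, control, rational specialisation, S3 by the
BCS comparison, three-way split of S1 on the coprime cell, one-variable cancellation against `μ(G⁻) = 0`). USE: a planner's ADD of the text «crux +
binders `W.frobeniusTrace p = 0` (after `HasGoodReductionAtPrime`) and `¬ p ∣ NumberField.classNumber K` (after `κ₂.IsAnticyclotomic →`)» has the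
2-stub skeleton `Cruxes/AnticyclotomicEisensteinDivisibility/Lines/bdpline_coprime_ss.lean` v4 (this seat) whose composition is this theorem.
CONDITIONAL on the two displayed hypotheses; the registered crux is not proved here; BSD is not advanced.

References: [LongoVigni2019] Boll. UMI 12 (2019) Thm. 1.4; [CastellaWan2023] Math. Ann. 389 (2024) Thm. 6.8; [Greenberg2016Selmer]
Prop. 4.1.1; [Greenberg2006] Props. 4.1/4.2; [MilneADT2006] I Thm. 5.1; [Harari2020] Thm. 17.13 (a) (proved in the tree at totally complex
fields); [BurungaleCastellaSkinner2025] Prop. 4.2.2 and its proof (§4.2, p. 9); [BertoliniLongoVenerucci2026] Thm. A; [CastellaEtAl2025]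
Thm. 7.1 / Cor. 7.2.
-/

-- `Summit.BirchSwinnertonDyer.BirchSwinnertonDyer.…`: summit and sub-problem share a name (D-0017 layout).
set_option linter.dupNamespace false
set_option autoImplicit false

noncomputable section

open scoped Classical

namespace Summit.BirchSwinnertonDyer.BirchSwinnertonDyer.Theorems.SignedBaseChangeAcDivCoprimeSupersingularBDPMultTateTC

open Summit.BirchSwinnertonDyer.BirchSwinnertonDyer.Theses.SignedBaseChange
open Literature.NumberTheory.EllipticCurves
open Summit.BirchSwinnertonDyer.BirchSwinnertonDyer.Theorems

/-- **The crux `AnticyclotomicEisensteinDivisibility` with the extra binders `W.frobeniusTrace p = 0` and `¬ p ∣ h_K`, from two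
stubs, v37 currency: `hF` = the v37 `stub_namedFactsSS` text of `Lines/bdpline.lean` WITHOUT its first conjunct (the Yan–Zhu triple) — SEVEN
conjuncts, Tate's global Euler characteristic only at totally complex fields, NO Poitou–Tate conjunct —, and `hT` = the research stub
`stub_bdpLowerHalfRatSS_mult` VERBATIM (BDP currency).** p680714's composition with the finite exponent of `X_Gr₂[T₁]` read from Greenberg 2016
Prop. 4.1.1 + Tate (TC) (`finiteExponentSS_of_prop411_of_tateTC`). CONDITIONAL on the two displayed hypotheses; the registered crux is not proved
here; BSD is not advanced. [cite: LongoVigni2019, Thm. 1.4] [cite: CastellaWan2023, Thm. 6.8 and its proof (MS pp. 29–31)]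
[cite: BurungaleCastellaSkinner2025, Prop. 4.2.2 and its proof (§4.2, p. 9)] [cite: Greenberg2016Selmer, Prop. 4.1.1] [cite: MilneADT2006, I Thm. 5.1]
[cite: BertoliniLongoVenerucci2026, Thm. A with Hyp. 1.1] [cite: CastellaEtAl2025, Thm. 7.1 and Cor. 7.2] -/
theorem anticyclotomicEisensteinDivisibility_ss_coprime_of_stubs_bdpmult_tateTC
    (hF : (∀ (W : WeierstrassCurve ℚ) [W.IsGloballyMinimal] (K : Type) [Field K] [NumberField K] (p : ℕ) [Fact p.Prime]
      (κ : Literature.NumberTheory.EllipticCurves.ZpExtension K p) (𝔭 𝔭' : IsDedekindDomain.HeightOneSpectrum (NumberField.RingOfIntegers K)),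
      Literature.NumberTheory.EllipticCurves.AcSigned.longoVigni2019_thm14_signedSelmerDual_rank_one W K p κ 𝔭 𝔭') ∧
    (∀ (N : ℕ) [NeZero N] (W : WeierstrassCurve ℚ) [W.IsGloballyMinimal] (K : Type) [Field K] [NumberField K] (p : ℕ) [Fact p.Prime]
      (κ : Literature.NumberTheory.EllipticCurves.ZpExtension K p) (𝔭 𝔭' : IsDedekindDomain.HeightOneSpectrum (NumberField.RingOfIntegers K)),
      Literature.NumberTheory.EllipticCurves.AcSigned.castellaWan2024_proofThm68_transferInputs N W K p κ 𝔭 𝔭') ∧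
    Literature.NumberTheory.EllipticCurves.BertoliniLongoVenerucci2026.thmA_castellaWan_thm68_exists_isCWBDPLFunction_charIdeal_map_le_rat ∧
    (Literature.NumberTheory.IwasawaTheory.Greenberg2016.prop411_selmer_isAlmostDivisible ∧
      (∀ (K : Type) [Field K] [NumberField K] [NumberField.IsTotallyComplex K], Literature.NumberTheory.GaloisCohomology.tateGlobalEulerPoincareCharacteristic K)) ∧
    Literature.NumberTheory.EllipticCurves.BurungaleCastellaSkinner2025.proofProp422_span_minus_eq_span_bdp_goodReduction ∧
    Literature.NumberTheory.EllipticCurves.BurungaleCastellaSkinner2025.prop422_exists_isBDPLFunction_mu_eq_zero ∧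
    Literature.NumberTheory.EllipticCurves.CastellaHsuKunduLeeLiu2025.thm71_cor72_exists_isCWBDPLFunction_charIdeal_map_le_rat)
    (hT : SignedTwoVariableInputs → Literature.NumberTheory.EllipticCurves.ModularForms.nonempty_modularParametrizationData → ∀ (W : WeierstrassCurve ℚ) [W.IsElliptic] [W.IsGloballyMinimal] (p : ℕ) [Fact p.Prime], 5 ≤ p → W.HasGoodReductionAtPrime p → W.frobeniusTrace p = 0 → Literature.NumberTheory.EllipticCurves.Rank1Residual.Surj W p → ∀ (K : Type) [Field K] [NumberField K] (ι : PadicAlgCl p ≃+* ℂ) (v vbar : IsDedekindDomain.HeightOneSpectrum (NumberField.RingOfIntegers K)) (κ₁ κ₂ : Literature.NumberTheory.EllipticCurves.ZpExtension K p) (γ₁ γ₂ : Field.absoluteGaloisGroup K) [Fact (Literature.NumberTheory.EllipticCurves.ZpExtension.IsTopGeneratorPair κ₁ κ₂ γ₁ γ₂)] [NeZero (NumberField.discr K).natAbs] (N : ℕ) [NeZero N] (f : CuspForm (CongruenceSubgroup.Gamma0 N) 2), Literature.NumberTheory.EllipticCurves.ModularForms.IsNewformOf W f → (N : ℤ) =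 W.conductorNorm ℤ → Literature.NumberTheory.EllipticCurves.IsImaginaryQuadratic K → ¬ p ∣ NumberField.classNumber K → ¬ (Squarefree N ∧ ∀ q : ℕ, q.Prime → q ∣ N → ∃ v' : IsDedekindDomain.HeightOneSpectrum (NumberField.RingOfIntegers ℚ), ((q : ℕ) : NumberField.RingOfIntegers ℚ) ∈ v'.asIdeal ∧ ∃ 𝔓 ∈ v'.primesAbove, ∃ σ ∈ 𝔓.inertia (Field.absoluteGaloisGroup ℚ), ∃ P : W.geomTorsion (p : ℤ), σ • P ≠ P) → ¬ (∀ ℓ : ℕ, ℓ.Prime → ℓ ∣ N → ℓ ^ 2 ∣ N) → ((Ideal.span {(p : ℤ)}).primesOver (NumberField.RingOfIntegers K)).ncard = 2 → ((p : ℕ) : NumberField.RingOfIntegers K) ∈ v.asIdeal → ((p : ℕ) : NumberField.RingOfIntegers K) ∈ vbar.asIdeal → vbar ≠ v → (∀ (w : NumberField.InfinitePlace K) (k : NumberField.RingOfIntegers K), k ∈ v.asIdeal ↔ ‖ι.symm (w.embedding (k : K))‖ < 1) → IsCoprime (N : ℤ) (NumberField.discr K) → (∀ ℓ : ℕ, ℓ.Prime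 → ℓ ∣ N → ((Ideal.span {(ℓ : ℤ)}).primesOver (NumberField.RingOfIntegers K)).ncard = 2) → Odd (NumberField.discr K) → NumberField.discr K ≠ -3 → κ₁.IsCyclotomic → κ₂.IsAnticyclotomic → (haveI : Fact (κ₂.IsTopGenerator γ₂) := ⟨Literature.NumberTheory.EllipticCurves.YanZhu2026.isTopGenerator_of_pair (κ₁ := κ₁) (γ₁ := γ₁)⟩; Module.IsTorsion (Literature.NumberTheory.EllipticCurves.IwasawaAlgebra p) (Literature.NumberTheory.EllipticCurves.Castella2018.AcSelmer.XAc (W.baseChange K) p κ₂ vbar ∅ γ₂)) → ∀ (ΩK : ℂ) (Ωp' : (Literature.NumberTheory.EllipticCurves.unrIntegers p)ˣ) (L : Literature.NumberTheory.EllipticCurves.UnrSeries p), ΩK ≠ 0 → Literature.NumberTheory.EllipticCurves.IsBDPLFunction ι v κ₂ γ₂ f ΩK ((Ωp' : Literature.NumberTheory.EllipticCurves.unrIntegers p) : PadicComplex p) L → ∀ J : ℤ_[p] →+* PadicComplexInt p, (∀ x : ℤ_[p], ((J x : PadicComplexInt p) : PadicComplex p) = ((x : ℚ_[p]) : PadicComplex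 p)) → ∀ (J₀ : Literature.NumberTheory.EllipticCurves.unrIntegers p →+* PadicComplexInt p), (∀ x : Literature.NumberTheory.EllipticCurves.unrIntegers p, ((J₀ x : PadicComplexInt p) : PadicComplex p) = (x : PadicComplex p)) → ∃ k : ℕ, ∀ y ∈ (haveI : Fact (κ₂.IsTopGenerator γ₂) := ⟨Literature.NumberTheory.EllipticCurves.YanZhu2026.isTopGenerator_of_pair (κ₁ := κ₁) (γ₁ := γ₁)⟩; Literature.NumberTheory.EllipticCurves.Castella2018.AcSelmer.XAc.charIdeal (W.baseChange K) p κ₂ vbar ∅ γ₂).map (PowerSeries.map J), PowerSeries.C (((p : ℕ) : PadicComplexInt p) ^ k) * y ∈ Ideal.span {PowerSeries.map J₀ L}) :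
    SignedTwoVariableInputs → Literature.NumberTheory.EllipticCurves.ModularForms.nonempty_modularParametrizationData → ∀ (W : WeierstrassCurve ℚ) [W.IsElliptic] [W.IsGloballyMinimal] (p : ℕ) [Fact p.Prime], 5 ≤ p → W.HasGoodReductionAtPrime p → W.frobeniusTrace p = 0 → Literature.NumberTheory.EllipticCurves.Rank1Residual.Surj W p → ∀ (K : Type) [Field K] [NumberField K] (ι : PadicAlgCl p ≃+* ℂ) (v vbar : IsDedekindDomain.HeightOneSpectrum (NumberField.RingOfIntegers K)) (κ₁ κ₂ : Literature.NumberTheory.EllipticCurves.ZpExtension K p) (γ₁ γ₂ : Field.absoluteGaloisGroup K) [Fact (Literature.NumberTheory.EllipticCurves.ZpExtension.IsTopGeneratorPair κ₁ κ₂ γ₁ γ₂)] [NeZero (NumberField.discr K).natAbs] (N : ℕ) [NeZero N] (f : CuspForm (CongruenceSubgroup.Gamma0 N) 2), Literature.NumberTheory.EllipticCurves.ModularForms.IsNewformOf W f → (N : ℤ) = W.conductorNorm ℤ → Literature.NumberTheory.EllipticCurves.IsImaginaryQuadratic K → ((Ideal.span {(p : ℤ)}).primesOver (NumberField.RingOfIntegers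 K)).ncard = 2 → ((p : ℕ) : NumberField.RingOfIntegers K) ∈ v.asIdeal → ((p : ℕ) : NumberField.RingOfIntegers K) ∈ vbar.asIdeal → vbar ≠ v → (∀ (w : NumberField.InfinitePlace K) (k : NumberField.RingOfIntegers K), k ∈ v.asIdeal ↔ ‖ι.symm (w.embedding (k : K))‖ < 1) → IsCoprime (N : ℤ) (NumberField.discr K) → (∀ ℓ : ℕ, ℓ.Prime → ℓ ∣ N → ((Ideal.span {(ℓ : ℤ)}).primesOver (NumberField.RingOfIntegers K)).ncard = 2) → Odd (NumberField.discr K) → NumberField.discr K ≠ -3 → κ₁.IsCyclotomic → κ₂.IsAnticyclotomic → ¬ p ∣ NumberField.classNumber K → ∀ (Ω δ : ℂ) (Ωp : (Literature.NumberTheory.EllipticCurves.unrIntegers p)ˣ) (LK G : PowerSeries (PowerSeries (PadicComplexInt p))), Ω ≠ 0 → (δ ^ 2 = (NumberField.discr K : ℂ) ∨ δ ^ 2 = -(NumberField.discr K : ℂ)) → Literature.NumberTheory.EllipticCurves.IsKatzMeasure₂ ι v vbar ∅ κ₁ κ₂ γ₁⁻¹ γ₂⁻¹ 1 Ω δ ((Ωp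 : Literature.NumberTheory.EllipticCurves.unrIntegers p) : PadicComplex p) LK → Literature.NumberTheory.EllipticCurves.IsGreenbergLFunctionAnyRoot₂ ι v vbar κ₁ κ₂ γ₁⁻¹ γ₂⁻¹ f (NumberField.discr K).natAbs (NumberField.classNumber K) LK G → ∀ J : ℤ_[p] →+* PadicComplexInt p, (∀ x : ℤ_[p], ((J x : PadicComplexInt p) : PadicComplex p) = ((x : ℚ_[p]) : PadicComplex p)) → ((WeierstrassCurve.XGr₂.charIdeal (W.baseChange K) p κ₁ κ₂ vbar γ₁ γ₂).map (Literature.NumberTheory.EllipticCurves.IwasawaAlgebra₂.toUnr₂ p J)).map (PowerSeries.constantCoeff (R := PowerSeries (PadicComplexInt p))) ≤ Ideal.span {Literature.NumberTheory.EllipticCurves.UnrSeries₂.minus G} := by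
  -- the named facts, projected (v37 tuple WITHOUT the Yan–Zhu triple; no Poitou–Tate conjunct, Tate at totally complex fields)
  obtain ⟨hLV, hCW, hBLV, ⟨hG1, hTate⟩, hbcs, h422e, hCHKLL⟩ := hF
  intro hIn hmodP W _ _ p _ hp hgood ha0 hs K _ _ ι v vbar κ₁ κ₂ γ₁ γ₂ _ _ N _ f hf hN hK hsplit hv hvbar hvv hι hcop hHeeg
    hodd hne3 hκ₁ hκ₂ hh Ω δ Ωp LK G hΩ hδ hLK hG J hJ
  -- NO ordinary slice: `a_p = 0` is a binder of the text (the K1″ glue only ever instantiates it on class X7)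
  have hγ₂ : κ₂.IsTopGenerator γ₂ := YanZhu2026.isTopGenerator_of_pair (κ₁ := κ₁) (γ₁ := γ₁)
  haveI : Fact (κ₂.IsTopGenerator γ₂) := ⟨hγ₂⟩
  -- S2a: finite generation = Nakayama for duals over Λ₂ + finiteness of `unrSelmer₂[𝔪]`
  haveI : (W.baseChange K).IsElliptic := by rw [WeierstrassCurve.baseChange]; infer_instance
  have hpair : ZpExtension.IsTopGeneratorPair κ₁ κ₂ γ₁ γ₂ := Fact.out
  have hfin := SignedBaseChangeAcDivFinitePiece.stub_finitePieceSS K (W.baseChange K) p κ₁ κ₂ vbar γ₁ γ₂ hpair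
  haveI hfg : Module.Finite (IwasawaAlgebra₂ p) ((W.baseChange K).XGr₂ p κ₁ κ₂ vbar γ₁ γ₂) := by
    refine SignedBaseChangeAcDivNakayamaTwoVar.stub_nakayamaDualTwoVar p (unrSelmer₂ κ₁ κ₂ (WeierstrassCurve.geomPrimaryTorsion (W.baseChange K) p) vbar)
      ((W.baseChange K).XGr₂ p κ₁ κ₂ vbar γ₁ γ₂)
      (conjSel₂ κ₁ κ₂ (WeierstrassCurve.geomPrimaryTorsion (W.baseChange K) p) vbar γ₁ - 1)
      (conjSel₂ κ₁ κ₂ (WeierstrassCurve.geomPrimaryTorsion (W.baseChange K) p) vbar γ₂ - 1)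
      (AddMonoidHom.id _) Function.bijective_id (fun x s ↦ ?_) (fun x s ↦ ?_) (fun c x s k hk ↦ ?_)
      (TwoVariableSelmer.isLocNil₂_conjSel₂ (WeierstrassCurve.geomPrimaryTorsion (W.baseChange K) p) vbar hpair
        ((W.baseChange K).exists_pow_smul_geomPrimaryTorsion_eq_zero p) ((W.baseChange K).isOpen_stabilizer_geomPrimaryTorsion' p)) ?_
    · show ((PowerSeries.X : IwasawaAlgebra₂ p) • x) s = x ((conjSel₂ κ₁ κ₂ (WeierstrassCurve.geomPrimaryTorsion (W.baseChange K) p) vbar γ₁ - 1) s)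
      rw [WeierstrassCurve.XGr₂.X_smul_apply, IwasawaDual.End_sub_apply, AddMonoid.End.one_apply]
      exact (AddMonoidHom.map_sub (show unrSelmer₂ κ₁ κ₂ (WeierstrassCurve.geomPrimaryTorsion (W.baseChange K) p) vbar →+
        AddCircle (1 : ℚ) from x) _ _).symm
    · show ((PowerSeries.C (PowerSeries.X : IwasawaAlgebra p) : IwasawaAlgebra₂ p) • x) s = x ((conjSel₂ κ₁ κ₂ (WeierstrassCurve.geomPrimaryTorsion (W.baseChange K) p) vbar γ₂ - 1) s)
      rw [WeierstrassCurve.XGr₂.CX_smul_apply, IwasawaDual.End_sub_apply, AddMonoid.End.one_apply]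
      exact (AddMonoidHom.map_sub (show unrSelmer₂ κ₁ κ₂ (WeierstrassCurve.geomPrimaryTorsion (W.baseChange K) p) vbar →+
        AddCircle (1 : ℚ) from x) _ _).symm
    · show ((PowerSeries.C (PowerSeries.C c : IwasawaAlgebra p) : IwasawaAlgebra₂ p) • x) s = (PadicInt.toZModPow k c).val • x s
      exact WeierstrassCurve.XGr₂.CC_smul_apply (W.baseChange K) p κ₁ κ₂ vbar γ₁ γ₂ c x hk
    · refine hfin.subset fun s hs ↦ ?_
      obtain ⟨h0, h1, h2⟩ := hs
      rw [IwasawaDual.End_sub_apply, AddMonoid.End.one_apply, sub_eq_zero] at h1 h2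
      exact ⟨h0, h1, h2⟩
  -- torsion of `X_Gr₂` from the ONE-variable torsion of `X_ac` on the REFEREED road (a1) — the only consumer of `p ∤ h_K`
  have hA1 := SignedBaseChangeAcDivXAcTorsionOfLongoVigni.xAcTorsionSS_of_longoVigni_castellaWan hLV hCW hIn hmodP W p hp hgood
    ha0 hs K ι v vbar κ₁ κ₂ γ₁ γ₂ N f hf hN hK hsplit hv hvbar hvv hι hcop hHeeg hodd hne3 hκ₁ hκ₂ hh
  have hV := SignedBaseChangeAcDivOfFacts.inertiaVanishingSS hIn hmodP W p hp hgood ha0 hs K ι v vbar κ₁ κ₂ γ₁ γ₂ N f hf hN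
    hK hsplit hv hvbar hvv hι hcop hHeeg hodd hne3 hκ₁ hκ₂
  have htors := SignedBaseChangeAcDivControlTorsion.stub_torsionSS_of_isTorsion_XAc_of_vanishing_of_away
    W p hp hgood ha0 hs K ι v vbar κ₁ κ₂ γ₁ γ₂ N f hf hN hK hsplit hv hvbar hvv hι hcop hHeeg hodd hne3 hκ₁ hκ₂ hA1 hV
    (SignedBaseChangeAcDivAwayDiscrepancy.stub_awayDiscrepancySS hIn hmodP W p hp hgood ha0 hs K ι v vbar κ₁ κ₂ γ₁ γ₂ N f hf hN
      hK hsplit hv hvbar hvv hι hcop hHeeg hodd hne3 hκ₁ hκ₂ hV)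
  obtain ⟨fc, hfc⟩ := SignedBaseChangeAcDivControl.stub_controlSurjSS hIn hmodP W p hp hgood ha0 hs K ι v vbar κ₁ κ₂ γ₁ γ₂ N f hf hN hK hsplit hv hvbar hvv hι hcop hHeeg hodd hne3 hκ₁ hκ₂
  obtain ⟨ΩK₃, Ωp₃, L₃, hΩK₃, hL₃, hcmp⟩ :=
    SignedBaseChangeAcDivMinusIsBDPSSBCS.stub_minusIsBDP_ss_of_bcs hbcs h422e hIn hmodP W p hp hgood ha0 hs K ι v vbar κ₁ κ₂ γ₁ γ₂ N f hf hN hK hsplit hv hvbar hvv hι hcop hHeeg hodd hne3 hκ₁ hκ₂ Ω δ Ωp LK G hΩ hδ hLK hG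
  -- dichotomy on `(T₁) ∈ Supp X_Gr₂`: if so, the specialised ideal is `⊥`
  by_cases h0 : Literature.NumberTheory.EllipticCurves.Module.lengthAt (IwasawaAlgebra₂ p) ((W.baseChange K).XGr₂ p κ₁ κ₂ vbar γ₁ γ₂)
      ⟨Ideal.span {(PowerSeries.X : IwasawaAlgebra₂ p)}, PowerSeries.span_X_isPrime⟩ = 0
  swap
  · rw [show WeierstrassCurve.XGr₂.charIdeal (W.baseChange K) p κ₁ κ₂ vbar γ₁ γ₂ =
        Literature.NumberTheory.EllipticCurves.Module.charIdeal (IwasawaAlgebra₂ p) ((W.baseChange K).XGr₂ p κ₁ κ₂ vbar γ₁ γ₂) from rfl,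
      SignedBaseChangeAcDivSpecialization.S2.map_toUnr₂_map_constantCoeff_eq_bot_of_lengthAt_ne_zero p _ htors h0 J]
    exact bot_le
  -- `(T₁) ∉ Supp X_Gr₂`: a killing element `s` with `s(0) ≠ 0` makes `X_ac` (a quotient of `X_Gr₂/T₁`) `Λ_ac`-torsion
  obtain ⟨s, hsX, hsm⟩ :=
    SignedBaseChangeAcDivSpecialization.LocalLength.exists_notMem_forall_smul_eq_zero_of_lengthAt_eq_zero h0
  have hs0 : PowerSeries.constantCoeff s ≠ 0 := fun h ↦ hsX
    ((SignedBaseChangeAcDivSpecialization.PowerSeriesSpecialization.mem_span_X_iff (A := IwasawaAlgebra p)).mpr h)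
  -- v37: finite exponent of `X_Gr₂[T₁]` from Greenberg 2016 Prop. 4.1.1 + Tate (TC) (Gr16 4.2.2 / Gr06 4.2 / §5 A tree theorems; Gr06 4.1 ⟸ Tate (TC) + proved PT (TC))
  have hm := SignedBaseChangeAcDivOfFiniteExponentTateTC.finiteExponentSS_of_prop411_of_tateTC hG1 hTate hIn hmodP W p hp hgood ha0 hs K ι v vbar κ₁ κ₂ γ₁ γ₂ N f hf hN hK hsplit hv hvbar hvv hι hcop hHeeg hodd hne3 hκ₁ hκ₂ h0
  have hXacTors : Module.IsTorsion (IwasawaAlgebra p) (Castella2018.AcSelmer.XAc (W.baseChange K) p κ₂ vbar ∅ γ₂) := by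
    letI : Module (IwasawaAlgebra p) (QuotSMulTop (PowerSeries.X : IwasawaAlgebra₂ p) ((W.baseChange K).XGr₂ p κ₁ κ₂ vbar γ₁ γ₂)) :=
      Module.compHom _ (PowerSeries.C (R := IwasawaAlgebra p))
    have hq : ∀ q : QuotSMulTop (PowerSeries.X : IwasawaAlgebra₂ p) ((W.baseChange K).XGr₂ p κ₁ κ₂ vbar γ₁ γ₂),
        (PowerSeries.constantCoeff s) • q = 0 := by
      intro q
      show (PowerSeries.C (PowerSeries.constantCoeff s) : IwasawaAlgebra₂ p) • q = 0
      have e : (PowerSeries.C (PowerSeries.constantCoeff s) : IwasawaAlgebra₂ p) =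
          (PowerSeries.C (PowerSeries.constantCoeff s) - s) + s := by ring
      obtain ⟨x, rfl⟩ := Submodule.Quotient.mk_surjective _ q
      rw [e, add_smul,
        SignedBaseChangeAcDivSpecialization.PowerSeriesSpecialization.smul_quotSMulTop_eq_zero
          _ _ (by rw [map_sub, PowerSeries.constantCoeff_C, sub_self]),
        zero_add, ← Submodule.Quotient.mk_smul, hsm, Submodule.Quotient.mk_zero]
    intro y
    obtain ⟨q, rfl⟩ := hfc y
    refine ⟨⟨PowerSeries.constantCoeff s, mem_nonZeroDivisors_of_ne_zero hs0⟩, ?_⟩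
    show (PowerSeries.constantCoeff s) • fc q = 0
    rw [← LinearMap.map_smul, hq, map_zero]
  -- μ(G⁻) = 0 from conjunct 1 of the crux's own antecedent (BCS25 Prop. 4.2.2; (irr_K) ⟸ Surj)
  have hμ : GreenbergVatsal2000.HasUnitContent (UnrSeries₂.minus G) :=
    SignedBaseChangeAcDivRatToInt.hasUnitContent_minus_of_prop422 hIn.1 W hp hgood hs
      K ι v vbar κ₁ κ₂ γ₁ γ₂ hf hN hK hsplit hv hvbar hvv hι hcop hHeeg hodd hne3 hκ₁ hκ₂ hΩ hδ hLK hG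
  let J₀ : unrIntegers p →+* PadicComplexInt p := Summit.BirchSwinnertonDyer.Rank1Residual.X11b.R1.unrToCpInt p
  have hJ₀ : ∀ x : unrIntegers p, ((J₀ x : PadicComplexInt p) : PadicComplex p) = (x : PadicComplex p) :=
    Summit.BirchSwinnertonDyer.Rank1Residual.X11b.R1.coe_unrToCpInt p
  -- RATIONAL specialisation `T₁ ↦ 0`
  obtain ⟨k₂, hk₂⟩ := SignedBaseChangeAcDivSpecialization.S2.xGr₂_specialization_le_rat
    (W.baseChange K) p κ₁ κ₂ vbar γ₁ γ₂ ⟨s, hs0, hsm⟩ hm fc hfc J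
  -- S1 on the coprime cell (v29 THREE-way split): all-additive ⟶ the BLV conjunct; square-free `N` with `E[p]` ramified at every
  -- `q ∣ N` ⟶ the CHKLL conjunct (p649308); otherwise ⟶ the research stub `hT` (v36, BDP currency) directly
  obtain ⟨k₁, hk₁⟩ : ∃ k : ℕ, ∀ y ∈ (Castella2018.AcSelmer.XAc.charIdeal (W.baseChange K) p κ₂ vbar ∅ γ₂).map (PowerSeries.map J),
      PowerSeries.C (((p : ℕ) : PadicComplexInt p) ^ k) * y ∈ Ideal.span {PowerSeries.map J₀ L₃} := by
    by_cases hsq : ∀ ℓ : ℕ, ℓ.Prime → ℓ ∣ N → ℓ ^ 2 ∣ N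
    · exact SignedBaseChangeAcDivBdpLowerHalfAllAdditive.bdpLowerHalfRatSS_allAdditive_of_BLV hBLV hIn hmodP W p hp hgood ha0 hs K ι
        v vbar κ₁ κ₂ γ₁ γ₂ N f hf hN hK hsplit hv hvbar hvv hι hcop hHeeg hodd hne3 hκ₁ hκ₂ hh hsq hXacTors ΩK₃ Ωp₃ L₃ hΩK₃ hL₃ J
        hJ J₀ hJ₀
    · by_cases hram : Squarefree N ∧ ∀ q : ℕ, q.Prime → q ∣ N →
          ∃ v' : IsDedekindDomain.HeightOneSpectrum (NumberField.RingOfIntegers ℚ),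
            ((q : ℕ) : NumberField.RingOfIntegers ℚ) ∈ v'.asIdeal ∧ ∃ 𝔓 ∈ v'.primesAbove,
              ∃ σ ∈ 𝔓.inertia (Field.absoluteGaloisGroup ℚ), ∃ P : W.geomTorsion (p : ℤ), σ • P ≠ P
      · exact SignedBaseChangeAcDivBdpLowerHalfSemistable.bdpLowerHalfRatSS_semistable_of_CHKLL hCHKLL hIn hmodP W p hp hgood ha0 hs K
          ι v vbar κ₁ κ₂ γ₁ γ₂ N f hf hN hK hsplit hv hvbar hvv hι hcop hHeeg hodd hne3 hκ₁ hκ₂ hh hram.1 hram.2 hXacTors ΩK₃ Ωp₃ L₃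
          hΩK₃ hL₃ J hJ J₀ hJ₀
      · -- v36: the research stub IS this branch (BDP currency; its own `hh`, `hram`, `hsq` are passed)
        exact hT hIn hmodP W p hp hgood ha0 hs K ι v vbar κ₁ κ₂ γ₁ γ₂ N f hf hN hK hh hram hsq hsplit hv hvbar hvv hι hcop hHeeg
          hodd hne3 hκ₁ hκ₂ hXacTors ΩK₃ Ωp₃ L₃ hΩK₃ hL₃ J hJ J₀ hJ₀
  -- rational S2 + rational S1 + μ(G⁻) = 0 ⟹ the integral inclusion (one-variable cancellation, k = k₁ + k₂)
  refine SignedBaseChangeAcDivRatToInt.le_span_of_forall_C_pow_mul_mem_of_hasUnitContent hμ (k := k₁ + k₂) fun y hy ↦ ?_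
  rw [hcmp J₀ hJ₀, pow_add, map_mul, mul_assoc]
  exact hk₁ _ (hk₂ y hy)

end Summit.BirchSwinnertonDyer.BirchSwinnertonDyer.Theorems.SignedBaseChangeAcDivCoprimeSupersingularBDPMultTateTC

end
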